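import Literature.Geometry.Lorentzian.CoordParallelFrames
import Literature.Geometry.Lorentzian.CoordRicciEvolution
import Literature.Geometry.Lorentzian.CoordCurvatureNormSq
import Literature.Analysis.PDE.HopfLemmas
import HarnessLib

/-!
# First and second order conditions at a pinching minimum, along geodesics with parallel frames

The calculus step of the classification of compact shrinking Ricci solitons by the maximum
principle for `λ_min(Ric)/R` (Eminenti–La Nave–Mantegazza 2008, §3, p. 7). The printed proof takes,
at the minimum point `p` of `λ_min/R` with eigenvector `v_p`, "a local unit smooth tangent vector
field `w` with `w(p) = v_p`, `∇w(p) = Δw(p) = 0`", so that "`RRR_{ij}wⁱwʲ/RRR` has a local minimum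
at `p`, `∇(RRR_{ij}wⁱwʲ/RRR)(p) = 0` and `Δ(RRR_{ij}wⁱwʲ/RRR)(p) ≥ 0`". We obtain the same first-
and second-order information WITHOUT the auxiliary field, by one-variable calculus along the
geodesics through `p` carrying the PARALLEL transport `W` of `v` (Hamilton's device, already in the
tree: `CoordParallelFrames.lean`): in the coordinate language (`MetricCoord`, metric components `G`
on an open `V`), for a smooth symmetric form field `β`, a smooth function `φ`, a constant `m` and a
vector `v` with the **pinching** `β_y(w,w) ≥ m φ(y) G_y(w,w)` on `V` and equality at `(x, v)`:

* `IsMetricOn.hasDerivAt_bilin_parallel`, `IsMetricOn.hasDerivAt_cov₂At_parallel` — along a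
  solution of `γ' = u`, `u' = −Γ(u,u)`, `W' = −Γ(u,W)`:
  `d/ds β_γ(W_a,W_b) = (∇_u β)(W_a,W_b)` and `d/ds (∇_u β)(W_a,W_b) = (∇²_{u,u} β)(W_a,W_b)`
  (`cov₂At`, `cov₃At`); `hasDerivAt_fderiv_geodesic` — `d/ds dφ_γ(u) = Hess φ(u,u)`;
* **`IsMetricOn.pinching_minimum`** — for every direction `X`:
  `(∇_X β)(v,v) = m dφ(X) G(v,v)` and `m Hess φ(X,X) G(v,v) ≤ (∇²_{X,X} β)(v,v)` (the function
  `s ↦ β(W,W) − m φ G(W,W)` along the geodesic in direction `X` is `≥ 0`, vanishes at `0`, and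
  `G(W,W)` is constant);
* **`IsMetricOn.pinching_minimum_laplacian`** — summed over a `G_x`-orthonormal basis:
  `m (Δφ) G(v,v) ≤ (Δβ)(v,v)` with the rough Laplacian `Δβ = lapBilinAt G β`
  (`CoordRicciEvolution.lean`).

Everything is proved; no definitions are introduced.

## References

* M. Eminenti, G. La Nave, C. Mantegazza, *Ricci solitons: the equation point of view*,
  manuscripta math. 127 (2008), §3 (p. 7). [EminentiLanaveMantegazza2008]
* R. S. Hamilton, *Four-manifolds with positive curvature operator*, J. Differential Geom. 24
  (1986), §4, proof of Lemma 4.2 (second derivatives along geodesics with parallel frames). [Hamilton1986]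
* B. O'Neill, *Semi-Riemannian geometry*, 1983, Ch. 3, Def. 3.18, Lemma 3.20, Prop. 3.37. [ONeill1983]
-/

noncomputable section

set_option maxSynthPendingDepth 3

open Set Filter Metric Module
open scoped Topology ContDiff

namespace Literature.Geometry.Lorentzian

namespace MetricCoord

variable {E : Type*} [NormedAddCommGroup E] [NormedSpace ℝ E] [FiniteDimensional ℝ E]
  [CompleteSpace E] {G : E → E →L[ℝ] E →L[ℝ] ℝ} {V : Set E}

/-! ### Derivatives along a geodesic with a parallel frame -/

section Dynamic

variable {ι : Type*} {γ u : ℝ → E} {W : ℝ → ι → E} {s : ℝ}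

omit [FiniteDimensional ℝ E] [CompleteSpace E] in
/-- **`d/ds β_γ(W_a, W_b) = (∇_u β)(W_a, W_b)`** along the geodesic/parallel system
(`W'_i = −Γ(u, W_i)`). [cite: ONeill1983, Ch. 3, Prop. 3.37] [cite: Hamilton1986, §4, p. 162] -/
theorem IsMetricOn.hasDerivAt_bilin_parallel (hγ : HasDerivAt γ (u s) s)
    (hW : ∀ i, HasDerivAt (fun σ ↦ W σ i) (-chrAt G (γ s) (u s) (W s i)) s)
    {β : E → E →L[ℝ] E →L[ℝ] ℝ} (hβ : DifferentiableAt ℝ β (γ s)) (a b : ι) :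
    HasDerivAt (fun σ ↦ β (γ σ) (W σ a) (W σ b)) (cov₂At G β (γ s) (u s) (W s a) (W s b)) s := by
  have hβγ : HasDerivAt (fun σ ↦ β (γ σ)) (fderiv ℝ β (γ s) (u s)) s :=
    hβ.hasFDerivAt.comp_hasDerivAt s hγ
  have h := (hβγ.clm_apply (hW a)).clm_apply (hW b)
  refine h.congr_deriv ?_
  rw [cov₂At_apply]
  simp only [map_neg, _root_.add_apply, _root_.neg_apply]
  abel

omit [FiniteDimensional ℝ E] in
/-- **`d/ds (∇_u β)(W_a, W_b) = (∇²_{u,u} β)(W_a, W_b)`** along a geodesic (`u' = −Γ(u,u)`) with a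
parallel frame. [cite: Hamilton1986, §4, p. 162] [cite: ONeill1983, Ch. 3, Prop. 3.37] -/
theorem IsMetricOn.hasDerivAt_cov₂At_parallel (hG : IsMetricOn G V) (hγV : γ s ∈ V)
    (hγ : HasDerivAt γ (u s) s) (hu : HasDerivAt u (-chrAt G (γ s) (u s) (u s)) s)
    (hW : ∀ i, HasDerivAt (fun σ ↦ W σ i) (-chrAt G (γ s) (u s) (W s i)) s)
    {β : E → E →L[ℝ] E →L[ℝ] ℝ} (hβ : ContDiffAt ℝ ∞ β (γ s)) (a b : ι) :
    HasDerivAt (fun σ ↦ cov₂At G β (γ σ) (u σ) (W σ a) (W σ b))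
      (cov₃At G (cov₂At G β) (γ s) (u s) (u s) (W s a) (W s b)) s := by
  have hPd : DifferentiableAt ℝ (cov₂At G β) (γ s) := hG.differentiableAt_cov₂At hγV hβ
  have hPγ : HasDerivAt (fun σ ↦ cov₂At G β (γ σ)) (fderiv ℝ (cov₂At G β) (γ s) (u s)) s :=
    hPd.hasFDerivAt.comp_hasDerivAt s hγ
  have h := ((hPγ.clm_apply hu).clm_apply (hW a)).clm_apply (hW b)
  refine h.congr_deriv ?_
  rw [cov₃At_apply]
  simp only [map_neg, _root_.add_apply, _root_.neg_apply]
  abel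

omit [FiniteDimensional ℝ E] [CompleteSpace E] in
/-- `d/ds φ(γ(s)) = dφ(u)`. [folklore] -/
theorem hasDerivAt_comp_curve {φ : E → ℝ} (hφ : DifferentiableAt ℝ φ (γ s))
    (hγ : HasDerivAt γ (u s) s) : HasDerivAt (fun σ ↦ φ (γ σ)) (fderiv ℝ φ (γ s) (u s)) s :=
  hφ.hasFDerivAt.comp_hasDerivAt s hγ

omit [FiniteDimensional ℝ E] [CompleteSpace E] in
/-- **`d/ds dφ_γ(u) = Hess φ(u,u)`** along a geodesic `u' = −Γ(u,u)` (the covariant Hessian of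
`CoordCurvature.lean`). [cite: ONeill1983, Ch. 3, Def. 3.49] -/
theorem hasDerivAt_fderiv_geodesic {φ : E → ℝ} (hφ : DifferentiableAt ℝ (fderiv ℝ φ) (γ s))
    (hγ : HasDerivAt γ (u s) s) (hu : HasDerivAt u (-chrAt G (γ s) (u s) (u s)) s) :
    HasDerivAt (fun σ ↦ fderiv ℝ φ (γ σ) (u σ)) (hessAt G φ (γ s) (u s) (u s)) s := by
  have hDγ : HasDerivAt (fun σ ↦ fderiv ℝ φ (γ σ)) (fderiv ℝ (fderiv ℝ φ) (γ s) (u s)) s :=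
    hφ.hasFDerivAt.comp_hasDerivAt s hγ
  refine (hDγ.clm_apply hu).congr_deriv ?_
  rw [hessAt_apply, map_neg]
  abel

end Dynamic

/-! ### The pinching minimum -/

section Minimum

variable {x : E}

omit [FiniteDimensional ℝ E] [CompleteSpace E] in
/-- Components of a solution of the geodesic/parallel system (one frame vector). [folklore] -/
private theorem hasDerivAt_components₁ {q : ℝ → E × E × (Fin 1 → E)} {σ : ℝ}
    (h : HasDerivAt q (geoField G (q σ)) σ) :
    HasDerivAt (fun τ ↦ (q τ).1) ((q σ).2.1) σ ∧
      HasDerivAt (fun τ ↦ (q τ).2.1) (-chrAt G (q σ).1 (q σ).2.1 (q σ).2.1) σ ∧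
      ∀ j, HasDerivAt (fun τ ↦ (q τ).2.2 j) (-chrAt G (q σ).1 (q σ).2.1 ((q σ).2.2 j)) σ := by
  refine ⟨?_, ?_, fun j ↦ ?_⟩
  · exact ((ContinuousLinearMap.fst ℝ E (E × (Fin 1 → E))).hasFDerivAt.comp_hasDerivAt σ h :)
  · exact (((ContinuousLinearMap.fst ℝ E (Fin 1 → E)).comp
      (ContinuousLinearMap.snd ℝ E (E × (Fin 1 → E)))).hasFDerivAt.comp_hasDerivAt σ h :)
  · exact (((ContinuousLinearMap.proj j : (Fin 1 → E) →L[ℝ] E).comp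
      ((ContinuousLinearMap.snd ℝ E (Fin 1 → E)).comp
        (ContinuousLinearMap.snd ℝ E (E × (Fin 1 → E))))).hasFDerivAt.comp_hasDerivAt σ h :)

/-- **First and second order conditions at a pinching minimum, in one direction**
(Eminenti–La Nave–Mantegazza 2008, §3, p. 7, via geodesics with parallel transport instead of the
auxiliary field `w`). Let `β` be a smooth form field and `φ` a smooth function on `V` with
`β_y(w,w) ≥ m φ(y) G_y(w,w)` for all `y ∈ V`, `w`, and equality at `(x, v)`. Then for every `X`:
`(∇_X β)(v,v) = m dφ(X) G(v,v)` and `m Hess φ(X,X) G(v,v) ≤ (∇²_{X,X} β)(v,v)`.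
[cite: EminentiLanaveMantegazza2008, §3 (p. 7)] [cite: Hamilton1986, §4, p. 162] -/
theorem IsMetricOn.pinching_minimum (hG : IsMetricOn G V) (hx : x ∈ V)
    {β : E → E →L[ℝ] E →L[ℝ] ℝ} (hβ : ContDiffOn ℝ ∞ β V) {φ : E → ℝ} (hφ : ContDiffOn ℝ ∞ φ V)
    {m : ℝ} {v : E} (hmin : ∀ y ∈ V, ∀ w, m * φ y * G y w w ≤ β y w w)
    (heq : β x v v = m * φ x * G x v v) (X : E) :
    cov₂At G β x X v v = m * fderiv ℝ φ x X * G x v v ∧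
      m * hessAt G φ x X X * G x v v ≤ cov₃At G (cov₂At G β) x X X v v := by
  -- the geodesic in direction `X` with the parallel transport of `v`
  set R : ℝ := max ‖X‖ ‖(fun _ : Fin 1 ↦ v)‖ with hR
  obtain ⟨ε, hε, L, -, D, -, hDV, hsol⟩ :=
    hG.exists_geodesicFrames (ι := Fin 1) (K := {x}) isCompact_singleton
      (singleton_subset_iff.2 hx) R
  obtain ⟨q, hq0, hqd, hqD, -⟩ :=
    hsol (x, X, fun _ ↦ v) rfl (le_max_left _ _) (le_max_right _ _)
  have hIoo : ∀ σ ∈ Ioo (-ε) ε, Icc (-ε) ε ∈ 𝓝 σ := fun σ hσ ↦ Icc_mem_nhds hσ.1 hσ.2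
  have hder : ∀ σ ∈ Ioo (-ε) ε, HasDerivAt q (geoField G (q σ)) σ := fun σ hσ ↦
    (hqd σ (Ioo_subset_Icc_self hσ)).hasDerivAt (hIoo σ hσ)
  have hV : ∀ σ ∈ Ioo (-ε) ε, (q σ).1 ∈ V := fun σ hσ ↦ hDV (hqD σ (Ioo_subset_Icc_self hσ))
  have h0 : (0 : ℝ) ∈ Ioo (-ε) ε := ⟨by linarith, hε⟩
  have hq01 : (q 0).1 = x := by rw [hq0]
  have hq02 : (q 0).2.1 = X := by rw [hq0]
  have hq03 : (q 0).2.2 0 = v := by rw [hq0]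
  -- smoothness along the curve
  have hβd : ∀ σ ∈ Ioo (-ε) ε, ContDiffAt ℝ ∞ β (q σ).1 := fun σ hσ ↦
    hβ.contDiffAt (hG.mem_nhds (hV σ hσ))
  have hφd : ∀ σ ∈ Ioo (-ε) ε, ContDiffAt ℝ ∞ φ (q σ).1 := fun σ hσ ↦
    hφ.contDiffAt (hG.mem_nhds (hV σ hσ))
  -- the comparison function and its derivatives
  set ψ : ℝ → ℝ := fun σ ↦ β (q σ).1 ((q σ).2.2 0) ((q σ).2.2 0)
    - m * (φ (q σ).1 * G (q σ).1 ((q σ).2.2 0) ((q σ).2.2 0)) with hψ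
  set ψ' : ℝ → ℝ := fun σ ↦ cov₂At G β (q σ).1 (q σ).2.1 ((q σ).2.2 0) ((q σ).2.2 0)
    - m * (fderiv ℝ φ (q σ).1 (q σ).2.1 * G (q σ).1 ((q σ).2.2 0) ((q σ).2.2 0)) with hψ'
  set ψ'' : ℝ → ℝ := fun σ ↦ cov₃At G (cov₂At G β) (q σ).1 (q σ).2.1 (q σ).2.1 ((q σ).2.2 0)
      ((q σ).2.2 0)
    - m * (hessAt G φ (q σ).1 (q σ).2.1 (q σ).2.1 * G (q σ).1 ((q σ).2.2 0) ((q σ).2.2 0))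
    with hψ''
  have hψd : ∀ σ ∈ Ioo (-ε) ε, HasDerivAt ψ (ψ' σ) σ := by
    intro σ hσ
    obtain ⟨h1, -, h3⟩ := hasDerivAt_components₁ (hder σ hσ)
    have hb := IsMetricOn.hasDerivAt_bilin_parallel (G := G) (γ := fun τ ↦ (q τ).1)
      (u := fun τ ↦ (q τ).2.1) (W := fun τ ↦ (q τ).2.2) h1 h3
      ((hβd σ hσ).differentiableAt (by simp)) 0 0
    have hf := hasDerivAt_comp_curve (γ := fun τ ↦ (q τ).1) (u := fun τ ↦ (q τ).2.1)
      ((hφd σ hσ).differentiableAt (by simp)) h1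
    have hg := hG.hasDerivAt_pairing_parallel (γ := fun τ ↦ (q τ).1) (u := fun τ ↦ (q τ).2.1)
      (W := fun τ ↦ (q τ).2.2) (hV σ hσ) h1 h3 0 0
    refine ((hb.sub ((hf.mul hg).const_mul m))).congr_deriv ?_
    simp only [hψ', mul_zero, add_zero]
  have hψ'd : ∀ σ ∈ Ioo (-ε) ε, HasDerivAt ψ' (ψ'' σ) σ := by
    intro σ hσ
    obtain ⟨h1, h2, h3⟩ := hasDerivAt_components₁ (hder σ hσ)
    have hb := hG.hasDerivAt_cov₂At_parallel (γ := fun τ ↦ (q τ).1) (u := fun τ ↦ (q τ).2.1)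
      (W := fun τ ↦ (q τ).2.2) (hV σ hσ) h1 h2 h3 (hβd σ hσ) 0 0
    have hDφ : DifferentiableAt ℝ (fderiv ℝ φ) (q σ).1 :=
      ((hφd σ hσ).fderiv_right (m := ∞) (by simp)).differentiableAt (by simp)
    have hf := hasDerivAt_fderiv_geodesic (G := G) (γ := fun τ ↦ (q τ).1)
      (u := fun τ ↦ (q τ).2.1) hDφ h1 h2
    have hg := hG.hasDerivAt_pairing_parallel (γ := fun τ ↦ (q τ).1) (u := fun τ ↦ (q τ).2.1)
      (W := fun τ ↦ (q τ).2.2) (hV σ hσ) h1 h3 0 0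
    refine ((hb.sub ((hf.mul hg).const_mul m))).congr_deriv ?_
    simp only [hψ'', mul_zero, add_zero]
  -- `ψ ≥ 0` near `0` and `ψ 0 = 0`: a local minimum
  have hψ0 : ψ 0 = 0 := by
    simp only [hψ, hq01, hq03, heq]
    ring
  have hψmin : IsLocalMin ψ 0 := by
    filter_upwards [Ioo_mem_nhds h0.1 h0.2] with σ hσ
    rw [hψ0]
    have h := hmin _ (hV σ hσ) ((q σ).2.2 0)
    simp only [hψ]
    linarith
  -- first order: `ψ'(0) = 0`
  have hfirst : ψ' 0 = 0 := hψmin.hasDerivAt_eq_zero (hψd 0 h0)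
  have hclaim1 : cov₂At G β x X v v = m * fderiv ℝ φ x X * G x v v := by
    have h := hfirst
    simp only [hψ', hq01, hq02, hq03] at h
    linarith
  refine ⟨hclaim1, ?_⟩
  -- second order: `ψ''(0) ≥ 0`
  have hcont : ContinuousAt ψ 0 := (hψd 0 h0).continuousAt
  have h2 := Literature.Analysis.PDE.deriv_deriv_nonneg_of_isLocalMin hψmin hcont
  have hderivψ : deriv ψ =ᶠ[𝓝 0] ψ' := by
    filter_upwards [Ioo_mem_nhds h0.1 h0.2] with σ hσ using (hψd σ hσ).deriv
  rw [hderivψ.deriv_eq, (hψ'd 0 h0).deriv] at h2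
  simp only [hψ'', hq01, hq02, hq03] at h2
  linarith

/-- **The traced second-order condition at a pinching minimum**: under the hypotheses of
`pinching_minimum` and with `G_x` positive definite, `m (Δφ)(x) G(v,v) ≤ (Δβ)_x(v,v)` for the
rough Laplacian `Δβ = tr_G ∇²β` (sum of the one-direction inequalities over a `G_x`-orthonormal
basis), together with the first-order identities `(∇_X β)(v,v) = m dφ(X) G(v,v)`. This is the
information "`∇(R_{ij}wⁱwʲ/R)(p) = 0`, `Δ(R_{ij}wⁱwʲ/R)(p) ≥ 0`" of the printed proof.
[cite: EminentiLanaveMantegazza2008, §3 (p. 7)] -/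
theorem IsMetricOn.pinching_minimum_laplacian (hG : IsMetricOn G V) (hx : x ∈ V)
    (hpos : ∀ w : E, w ≠ 0 → 0 < G x w w)
    {β : E → E →L[ℝ] E →L[ℝ] ℝ} (hβ : ContDiffOn ℝ ∞ β V) {φ : E → ℝ} (hφ : ContDiffOn ℝ ∞ φ V)
    {m : ℝ} {v : E} (hmin : ∀ y ∈ V, ∀ w, m * φ y * G y w w ≤ β y w w)
    (heq : β x v v = m * φ x * G x v v) :
    (∀ X, cov₂At G β x X v v = m * fderiv ℝ φ x X * G x v v) ∧
      m * lapAt G φ x * G x v v ≤ lapBilinAt G β x v v := by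
  have hi := hG.isInvertible x hx
  refine ⟨fun X ↦ (hG.pinching_minimum hx hβ hφ hmin heq X).1, ?_⟩
  classical
  obtain ⟨e, he⟩ := exists_orthonormal_basis (hG.symm x hx) hpos
  have hlapφ : lapAt G φ x = ∑ k, hessAt G φ x (e k) (e k) := by
    rw [lapAt_eq_sum G e φ x]
    refine Finset.sum_congr rfl fun k _ ↦ ?_
    simp only [← hessAt_apply, sum_ginv_mul_of_orthonormal e he hi]
  have hlapβ : lapBilinAt G β x v v = ∑ k, cov₃At G (cov₂At G β) x (e k) (e k) v v := by
    rw [lapBilinAt_apply_eq_sum G β e x v v]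
    refine Finset.sum_congr rfl fun k _ ↦ ?_
    rw [sum_ginv_mul_of_orthonormal e he hi (fun l ↦ cov₃At G (cov₂At G β) x (e k) (e l) v v) k]
  rw [hlapφ, hlapβ, Finset.mul_sum, Finset.sum_mul]
  exact Finset.sum_le_sum fun k _ ↦ (hG.pinching_minimum hx hβ hφ hmin heq (e k)).2

end Minimum

end MetricCoord

end Literature.Geometry.Lorentzian

end
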